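import Literature.Probability.LatticeModels.DobrushinMetricInfiniteRangeKernel
import Summits.Ventures.YMGap.RobustBall.BoundaryDecaySummableSU2
import HarnessLib

/-!
# Venture YMGap, track ROBUST-BALL — FINITE-VOLUME CLUSTERING UNIFORM IN THE VOLUME AND THE BOUNDARY FIELD,
# TIER 2: SUMMABLE (infinite-range) members cluster inside every finite volume with EVERY boundary field

HONEST FRAMING. WHAT THIS IS: a venture file (cell `pub-ymgap`, track Y2 ROBUST-BALL, seat ds-3, theorems only), the TIER-2 twin
of `KernelClusteringBall.lean` (object «C-KMIX-S»). A tier-2 member is `N β S_W + W` with `W` ANY link potential on `ℤ^d` with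
continuous own-link terms and a summable majorant (specification `perturbedYMS`, rb-p1's `SummableSpecification.lean`); its Dobrushin
matrix has SUMMABLE rows, so the finite-neighbourhood kernel estimate behind tier 1 (`KernelClustering.abs_covariance_kernel_le`)
does not apply. It is replaced by the Literature's infinite-range covariance estimate for the CONDITIONAL specification
(`DobrushinMetric.abs_covariance_kernel_le_of_summable_weighted`: Föllmer 1988, Ch. I, Thm. (2.13)/(2.14) for (2.10), the sweep from
the estimate `R·𝟙_Λ`):
* `KernelClusteringS.abs_covariance_kernel_le_exp_profile` / `_exp_dist` — ★ GENERIC (any specification on any `V → S` whose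
  one-site laws obey the global Kantorovich–Rubinstein bound with summable WEIGHTED rows `∑' C x y e^{t d(x,y)} ≤ c < 1` off
  `Δ_g`): for EVERY finite `Λ`, EVERY `η`, local Lipschitz `f, g` and a `d`-Lipschitz profile `ρ ≥ 0` vanishing on `Δ_g`:
  `|cov_{γ_Λ(·|η)}(f, g)| ≤ 2 R² (∑ δ_g) ∑_{Δ_f} e^{−t ρ} δ_f`, `≤ 2 R² (∑ δ_g)(∑ δ_f) e^{−t m}` if `ρ ≥ m` on `Δ_f`;
* ★★ `kernelS_covariance_decay` — TIER 2, `SU(N)`, `d ≥ 1`: under rb-p1's single weighted ROW CONDITION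
  `6(d−1)|β| e^{a} e^{t} √(c v) + e^{a/2} √c Λ_t < 1` (the hypothesis of `perturbedMassGapS_SU` / `abs_boundaryS_sub_integral_le`,
  same loads, same one-link pair `(c, v)`), for every finite link volume `Λ`, EVERY boundary field `η` and all Lipschitz cylinders
  `F₁` (links `Λ₁`, constant `K₁`), `F₂` (links `Λ₂`, constant `K₂`):
  `|cov_{γ^{W,S}_Λ(·|η)}(F₁, F₂)| ≤ 2(2√N)² #Λ₁ #Λ₂ K₁ K₂ · e^{−t d(Λ₁,Λ₂)}` — the finite volume clusters at the Dobrushin weight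
  rate `t`, with ONE constant for all volumes and all boundary fields (the DLR-state row is rb-p1's `perturbedMassGapS_SU`);
* ★ `suN_kernelS_covariance_decay_bakryEmery` (every `N ≥ 2`, hypothesis-free Bakry–Émery pair, packaged on `MemBallZdS`),
  ★★ `su2_kernelS_covariance_decay` (`SU(2)`, sharp pair `(2/3, 8/3)`, hypothesis-free: `2(d−1)|β_W| e^{a} e^{t} + e^{a/2}√(2/3)Λ_t < 1`)
  and `su2_kernelS_covariance_decay_of_memBallZdS`.
WHAT THIS IS NOT: strong-coupling LATTICE statements inside the tier-2 ball (Kantorovich / Lipschitz-observable form of finite-volume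
mixing); not the total-variation form, not complete analyticity; the rate is the Dobrushin weight `t`, not a spectral gap; nothing
about the continuum limit or the Clay Millennium problem.

References: H. Föllmer, LNM 1362 (1988), Ch. I, (2.10), Thm. (2.13), Cor. (2.14), (2.23)–(2.24); H.-O. Georgii, *Gibbs Measures and
Phase Transitions* (2011), Thm. 8.20, Remark 8.26; R. L. Dobrushin, S. B. Shlosman, J. Stat. Phys. 46 (1987) 983–1014; the
Literature's `DobrushinMetricInfiniteRangeKernel.lean`; rb-p1's `SummableMassGap.lean`; the seat's `KernelClusteringBall.lean` (tier 1)
and `BoundaryDecaySummable.lean` (tier-2 boundary decay).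
-/

noncomputable section

open MeasureTheory Filter Function ProbabilityTheory Real Topology
open scoped NNReal
open Literature.Probability.LatticeModels
open Literature.Probability.LatticeModels.DobrushinMetric
open Literature.MathematicalPhysics.QuantumLattice
open Literature.MathematicalPhysics.QuantumFieldTheory hiding ZdEdge
open Summit.QuantumFields.BalabanUV.InfraRed.StrongCouplingPoincareDoorSUN (oneLinkPoincareSUN_two_sharp oneLinkPoincareSUN_bakryEmery)
open Summit.QuantumFields.BalabanUV.InfraRed.StrongCouplingVarianceDoorSUN (oneLinkVarianceBound_bakryEmery)

namespace Summit.Ventures.YMGap.RobustBall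

/-! ### Generic: exponential weights for the kernel covariance estimate, summable rows -/

namespace KernelClusteringS

variable {V S : Type*} [MeasurableSpace S] {γ : Specification V S} {r : S → S → ℝ} {C : V → V → ℝ}

/-- ★ **Exponential decay of the finite-volume covariances under the weighted Dobrushin condition, infinite range with summable
rows** (Föllmer 1988, Ch. I, (2.23)–(2.24) for the conditional specification (2.10); Georgii 2011, Remark 8.26): with `d ≥ 0`,
`t ≥ 0`, the WEIGHTED rows `y ↦ C x y e^{t d x y}` summable with sum `≤ c < 1` off `Δ_g`, and a profile `ρ ≥ 0` vanishing on `Δ_g`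
with `ρ x ≤ ρ y + d x y` (`x ∉ Δ_g`): for EVERY finite `Λ` and EVERY boundary condition `η`,
`|cov_{γ_Λ(·|η)}(f, g)| ≤ 2 R² (∑_{Δ_g} δ_g) ∑_{y ∈ Δ_f} e^{−t ρ y} δ_f y`. [folklore] -/
theorem abs_covariance_kernel_le_exp_profile [DecidableEq V] (hγ : IsSpecification γ)
    {R : ℝ} (hr0 : ∀ a b, 0 ≤ r a b) (hrR : ∀ a b, r a b ≤ R) (hR : 0 ≤ R) (hr00 : ∀ a, r a a = 0)
    (hC0 : ∀ x y, 0 ≤ C x y) (hCs : ∀ x, Summable (C x))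
    (hcontr : ∀ (x : V) (ω η : V → S) (φ : S → ℝ) (L : ℝ), Measurable φ →
      (∃ M, ∀ s, |φ s| ≤ M) → 0 ≤ L → (∀ a b, |φ a - φ b| ≤ L * r a b) →
      |∫ s, φ s ∂(siteLaw γ x ω) - ∫ s, φ s ∂(siteLaw γ x η)| ≤ L * ∑' y, C x y * r (ω y) (η y))
    (Λ : Finset V) (η : V → S) {f g : (V → S) → ℝ}
    (hfm : Measurable f) {Δf : Finset V} (hfdep : DependsOn f (↑Δf : Set V)) {Mf : ℝ} (hMf : ∀ σ, |f σ| ≤ Mf)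
    {δf : V → ℝ} (hδf : IsLipBound r f δf) (hgm : Measurable g) {Δg : Finset V} (hgdep : DependsOn g (↑Δg : Set V))
    {Mg : ℝ} (hMg : ∀ σ, |g σ| ≤ Mg) {δg : V → ℝ} (hδg : IsLipBound r g δg) {c : ℝ} (hc0 : 0 ≤ c) (hc1 : c < 1)
    (d : V → V → ℝ) (hd : ∀ x y, 0 ≤ d x y) {t : ℝ} (ht : 0 ≤ t)
    (hsw : ∀ x ∉ Δg, Summable fun y => C x y * Real.exp (t * d x y))
    (hroww : ∀ x ∉ Δg, ∑' y, C x y * Real.exp (t * d x y) ≤ c)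
    (ρ : V → ℝ) (hρ0 : ∀ y, 0 ≤ ρ y) (hρg : ∀ y ∈ Δg, ρ y = 0) (hρ : ∀ x ∉ Δg, ∀ y, ρ x ≤ ρ y + d x y) :
    |cov[f, g; γ Λ η]| ≤ 2 * R ^ 2 * (∑ y ∈ Δg, δg y) * ∑ y ∈ Δf, Real.exp (-(t * ρ y)) * δf y := by
  have hθ0 : ∀ y, 0 ≤ Real.exp (-(t * ρ y)) := fun y => (Real.exp_pos _).le
  have hθ1 : ∀ y, Real.exp (-(t * ρ y)) ≤ 1 := fun y => Real.exp_le_one_iff.2 (by nlinarith [hρ0 y])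
  have hθg : ∀ y ∈ Δg, Real.exp (-(t * ρ y)) = 1 := fun y hy => by rw [hρg y hy]; simp
  have hsθ : ∀ x, Summable fun y => C x y * Real.exp (-(t * ρ y)) := fun x =>
    Summable.of_nonneg_of_le (fun y => mul_nonneg (hC0 x y) (hθ0 y))
      (fun y => by simpa using mul_le_mul_of_nonneg_left (hθ1 y) (hC0 x y)) (hCs x)
  have hrow : ∀ x ∉ Δg, ∑' y, C x y ≤ c := fun x hx => by
    refine le_trans ((hCs x).tsum_le_tsum (fun y => ?_) (hsw x hx)) (hroww x hx)
    have h1 : (1 : ℝ) ≤ Real.exp (t * d x y) := Real.one_le_exp (mul_nonneg ht (hd x y))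
    simpa using mul_le_mul_of_nonneg_left h1 (hC0 x y)
  refine abs_covariance_kernel_le_of_summable_weighted hγ hr0 hrR hR hr00 hC0 hCs hcontr Λ η hfm hfdep hMf hδf hgm hgdep
    hMg hδg hc0 hc1 hrow hθ0 hθ1 hθg (fun x hx => ?_)
  calc ∑' y, C x y * Real.exp (-(t * ρ y))
      ≤ ∑' y, C x y * Real.exp (t * d x y) * Real.exp (-(t * ρ x)) := by
        refine (hsθ x).tsum_le_tsum (fun y => ?_) ((hsw x hx).mul_right _)
        rw [mul_assoc, ← Real.exp_add]
        refine mul_le_mul_of_nonneg_left (Real.exp_le_exp.2 ?_) (hC0 x y)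
        nlinarith [hρ x hx y]
    _ = (∑' y, C x y * Real.exp (t * d x y)) * Real.exp (-(t * ρ x)) := tsum_mul_right
    _ ≤ c * Real.exp (-(t * ρ x)) := mul_le_mul_of_nonneg_right (hroww x hx) (Real.exp_pos _).le

/-- ★ **At separation `m`** (Föllmer 1988, Ch. I, (2.24); Künsch 1982): if moreover `ρ ≥ m` on `Δ_f` then, for EVERY finite `Λ`
and EVERY `η`, `|cov_{γ_Λ(·|η)}(f, g)| ≤ 2 R² (∑_{Δ_g} δ_g) (∑_{Δ_f} δ_f) e^{−t m}` — the finite-volume kernels cluster at the rate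
`t` of the Dobrushin weight, uniformly in the volume and the boundary condition. [folklore] -/
theorem abs_covariance_kernel_le_exp_dist [DecidableEq V] (hγ : IsSpecification γ)
    {R : ℝ} (hr0 : ∀ a b, 0 ≤ r a b) (hrR : ∀ a b, r a b ≤ R) (hR : 0 ≤ R) (hr00 : ∀ a, r a a = 0)
    (hC0 : ∀ x y, 0 ≤ C x y) (hCs : ∀ x, Summable (C x))
    (hcontr : ∀ (x : V) (ω η : V → S) (φ : S → ℝ) (L : ℝ), Measurable φ →
      (∃ M, ∀ s, |φ s| ≤ M) → 0 ≤ L → (∀ a b, |φ a - φ b| ≤ L * r a b) →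
      |∫ s, φ s ∂(siteLaw γ x ω) - ∫ s, φ s ∂(siteLaw γ x η)| ≤ L * ∑' y, C x y * r (ω y) (η y))
    (Λ : Finset V) (η : V → S) {f g : (V → S) → ℝ}
    (hfm : Measurable f) {Δf : Finset V} (hfdep : DependsOn f (↑Δf : Set V)) {Mf : ℝ} (hMf : ∀ σ, |f σ| ≤ Mf)
    {δf : V → ℝ} (hδf : IsLipBound r f δf) (hgm : Measurable g) {Δg : Finset V} (hgdep : DependsOn g (↑Δg : Set V))
    {Mg : ℝ} (hMg : ∀ σ, |g σ| ≤ Mg) {δg : V → ℝ} (hδg : IsLipBound r g δg) {c : ℝ} (hc0 : 0 ≤ c) (hc1 : c < 1)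
    (d : V → V → ℝ) (hd : ∀ x y, 0 ≤ d x y) {t : ℝ} (ht : 0 ≤ t)
    (hsw : ∀ x ∉ Δg, Summable fun y => C x y * Real.exp (t * d x y))
    (hroww : ∀ x ∉ Δg, ∑' y, C x y * Real.exp (t * d x y) ≤ c)
    (ρ : V → ℝ) (hρ0 : ∀ y, 0 ≤ ρ y) (hρg : ∀ y ∈ Δg, ρ y = 0) (hρ : ∀ x ∉ Δg, ∀ y, ρ x ≤ ρ y + d x y)
    {m : ℝ} (hm : ∀ y ∈ Δf, m ≤ ρ y) :
    |cov[f, g; γ Λ η]| ≤ 2 * R ^ 2 * (∑ y ∈ Δg, δg y) * (∑ y ∈ Δf, δf y) * Real.exp (-(t * m)) := by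
  refine (abs_covariance_kernel_le_exp_profile hγ hr0 hrR hR hr00 hC0 hCs hcontr Λ η hfm hfdep hMf hδf hgm hgdep hMg hδg hc0 hc1
    d hd ht hsw hroww ρ hρ0 hρg hρ).trans ?_
  have h1 : ∑ y ∈ Δf, Real.exp (-(t * ρ y)) * δf y ≤ ∑ y ∈ Δf, Real.exp (-(t * m)) * δf y :=
    Finset.sum_le_sum fun y hy => mul_le_mul_of_nonneg_right (Real.exp_le_exp.2 (by nlinarith [hm y hy])) (hδf.nonneg y)
  have h2 : 0 ≤ 2 * R ^ 2 * ∑ y ∈ Δg, δg y := by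
    have : 0 ≤ ∑ y ∈ Δg, δg y := Finset.sum_nonneg fun y _ => hδg.nonneg y
    positivity
  calc 2 * R ^ 2 * (∑ y ∈ Δg, δg y) * ∑ y ∈ Δf, Real.exp (-(t * ρ y)) * δf y
      ≤ 2 * R ^ 2 * (∑ y ∈ Δg, δg y) * ∑ y ∈ Δf, Real.exp (-(t * m)) * δf y := mul_le_mul_of_nonneg_left h1 h2
    _ = 2 * R ^ 2 * (∑ y ∈ Δg, δg y) * (∑ y ∈ Δf, δf y) * Real.exp (-(t * m)) := by rw [← Finset.mul_sum]; ring

end KernelClusteringS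

/-! ### Tier 2, `SU(N)`: every finite volume of a summable member clusters, with every boundary field -/

section SUN

variable {d N : ℕ}
variable {W : Potential (ZdEdge d) (Matrix.specialUnitaryGroup (Fin N) ℂ)} {B : Finset (ZdEdge d) → ℝ}

/-- ★★ **TIER 2: FINITE-VOLUME CLUSTERING UNIFORM IN THE VOLUME AND THE BOUNDARY FIELD, at the Dobrushin weight rate `t`**
(Föllmer 1988, Ch. I, (2.10) with Thm. (2.13)/Cor. (2.14); Georgii 2011, Remark 8.26). Under rb-p1's weighted row condition
`6(d−1)|β| e^{a} e^{t} √(c v) + e^{a/2} √c Λ_t < 1` for the member `N β S_W + W` (one-link Poincaré/variance pair `(c, v)` on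
`‖B‖_op ≤ 2(d−1)|β|`, oscillation load `a`, diagonal-free weighted cross load `Λ_t`, exactly the hypotheses of `perturbedMassGapS_SU`):
for every finite link volume `Λ`, EVERY boundary field `η`, and all Lipschitz cylinders `F₁` (links `Λ₁`, constant `K₁`), `F₂` (links
`Λ₂`, constant `K₂`): `|cov_{γ^{W,S}_Λ(· | η)}(F₁, F₂)| ≤ 2(2√N)² · #Λ₁ #Λ₂ K₁ K₂ · e^{−t d(Λ₁,Λ₂)}`, `d` the `ℓ^∞` base-point distance
`setDistEdges` — the profile is `dist(·, Λ₂)`. [folklore] -/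
theorem kernelS_covariance_decay (hd : 1 ≤ d) (hN : 1 ≤ N) {β b c v a Λt t : ℝ}
    (hc : 0 ≤ c) (hv : 0 ≤ v) (hb : |β| * (2 * ((d : ℝ) - 1)) ≤ b)
    (hP : ∀ B : Matrix (Fin N) (Fin N) ℂ, matrixOpNorm B ≤ b →
      ∀ (ψ : Matrix.specialUnitaryGroup (Fin N) ℂ → ℝ) (M : ℝ), 0 ≤ M →
        (∀ x y, |ψ x - ψ y| ≤ M * suFrobDist x y) →
        Var[ψ; (haarProbability (Matrix.specialUnitaryGroup (Fin N) ℂ)).tilted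
          fun g => (N : ℝ) * ((g : Matrix (Fin N) (Fin N) ℂ) * B).trace.re] ≤ c * M ^ 2)
    (hVB : ∀ B : Matrix (Fin N) (Fin N) ℂ, matrixOpNorm B ≤ b → ∀ Δ : Matrix (Fin N) (Fin N) ℂ,
      Var[fun g : Matrix.specialUnitaryGroup (Fin N) ℂ =>
          (N : ℝ) * ((g : Matrix (Fin N) (Fin N) ℂ) * Δ).trace.re;
        (haarProbability (Matrix.specialUnitaryGroup (Fin N) ℂ)).tilted
          fun g => (N : ℝ) * ((g : Matrix (Fin N) (Fin N) ℂ) * B).trace.re] ≤ v * frobNorm Δ ^ 2)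
    (h : IsLinkSummable W B) (hWc : ∀ X, Continuous (W X))
    (hWdep : ∀ X, DependsOn (W X) (↑X : Set (ZdEdge d)))
    {osc : Finset (ZdEdge d) → ZdEdge d → ℝ} (hosc : ∀ X, Dobrushin.IsOscBound (W X) (osc X))
    (hoscs : ∀ e, Summable fun X : Finset (ZdEdge d) => (if e ∈ X then osc X e else 0))
    (hosca : ∀ e, ∑' X : Finset (ZdEdge d), (if e ∈ X then osc X e else 0) ≤ a)
    {lip : Finset (ZdEdge d) → ZdEdge d → ℝ} (hlip : ∀ X, IsLipBound suFrobDist (W X) (lip X))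
    {ℓ : ZdEdge d → ZdEdge d → ℝ}
    (hlips : ∀ e y, Summable fun X : Finset (ZdEdge d) => (if e ∈ X ∧ y ∈ X then lip X y else 0))
    (hℓ : ∀ e y, y ≠ e → ∑' X : Finset (ZdEdge d), (if e ∈ X ∧ y ∈ X then lip X y else 0) ≤ ℓ e y)
    (ht : 0 ≤ t) (hℓs : ∀ e, Summable fun y => (if y = e then 0 else ℓ e y) * exp (t * ‖e.1 - y.1‖))
    (hℓt : ∀ e, ∑' y, (if y = e then 0 else ℓ e y) * exp (t * ‖e.1 - y.1‖) ≤ Λt)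
    (hρ : 6 * ((d : ℝ) - 1) * |β| * (exp a * exp t * Real.sqrt (c * v)) + exp (a / 2) * Real.sqrt c * Λt < 1)
    (Λ : Finset (ZdEdge d)) (η : LGConfig d (Matrix.specialUnitaryGroup (Fin N) ℂ))
    {F₁ F₂ : LGConfig d (Matrix.specialUnitaryGroup (Fin N) ℂ) → ℝ} {Λ₁ Λ₂ : Finset (ZdEdge d)} {K₁ K₂ : ℝ≥0}
    (hF₁ : IsLipschitzCylinder (fundamentalRep (Fin N)) F₁ Λ₁ K₁)
    (hF₂ : IsLipschitzCylinder (fundamentalRep (Fin N)) F₂ Λ₂ K₂) :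
    |cov[F₁, F₂; perturbedYMS (d := d) (fundamentalRep (Fin N)) (N * β) W Λ η]| ≤
      2 * (2 * Real.sqrt N) ^ 2 * Λ₁.card * Λ₂.card * ((K₁ : ℝ) * K₂) * exp (-(t * setDistEdges Λ₁ Λ₂)) := by
  classical
  haveI : SecondCountableTopology (Matrix (Fin N) (Fin N) ℂ) :=
    inferInstanceAs (SecondCountableTopology (Fin N → Fin N → ℂ))
  haveI : SecondCountableTopology (Matrix.specialUnitaryGroup (Fin N) ℂ) :=
    Topology.IsEmbedding.subtypeVal.secondCountableTopology
  have hγ : IsSpecification (perturbedYMS (d := d) (fundamentalRep (Fin N)) (N * β) W) :=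
    isSpecification_perturbedYMS _ (continuous_fundamentalRep (Fin N)) _ h hWc hWdep
  have hℓ0 : ∀ x y, y ≠ x → 0 ≤ ℓ x y := fun x y hyx => by
    refine le_trans (tsum_nonneg fun X => ?_) (hℓ x y hyx)
    split_ifs
    · exact (hlip X).nonneg y
    · exact le_rfl
  have hrow := fun x => summable_coeffS_row₀ (β := β) (c := c) (v := v) (a := a) hd hℓ0 ht hℓs hℓt x
  have hℓs' : ∀ e, Summable fun y => (if y = e then 0 else ℓ e y) := fun e =>
    Summable.of_nonneg_of_le (fun y => by split_ifs with hye; exacts [le_rfl, hℓ0 e y hye])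
      (fun y => le_mul_of_one_le_right (by split_ifs with hye; exacts [le_rfl, hℓ0 e y hye])
        (one_le_exp (by positivity))) (hℓs e)
  have hC0 : ∀ x y : ZdEdge d, 0 ≤ (if y = x then 0 else
      (exp a * Real.sqrt (c * v) * |β| * linkInfluence x y + exp (a / 2) * Real.sqrt c * ℓ x y)) :=
    fun x y => by
      split_ifs with hyx
      · exact le_rfl
      · exact add_nonneg (by positivity) (mul_nonneg (by positivity) (hℓ0 x y hyx))
  have hρ0 : 0 ≤ 6 * ((d : ℝ) - 1) * |β| * (exp a * exp t * Real.sqrt (c * v)) + exp (a / 2) * Real.sqrt c * Λt := by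
    have hd0 : 0 < d := hd
    let e₀ : ZdEdge d := (0, ⟨0, hd0⟩)
    exact (tsum_nonneg (hC0 e₀)).trans (hrow e₀).2.2.1
  have hRsqrt : (0 : ℝ) ≤ 2 * Real.sqrt N := by positivity
  haveI := hγ.isProbability Λ η
  have key := KernelClusteringS.abs_covariance_kernel_le_exp_dist hγ (fun _ _ => suFrobDist_nonneg _ _) suFrobDist_le
    hRsqrt suFrobDist_self hC0 (fun x => (hrow x).1)
    (fun x ω η' φ L hφm hφb hL hφL => abs_integral_siteLaw_perturbedYMS_sub_le_tsum₀ hd hN hc hv hb hP hVB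
      h hWc hWdep hosc hoscs hosca hlip hlips hℓ hℓs' x ω η' φ L hφm hφb hL hφL)
    Λ η hF₁.measurable hF₁.dependsOn hF₁.abs_le
    (hF₁.isLipBound zero_le_one (fun a b => by rw [one_mul]; exact dist_suEntries_le_suFrobDist a b))
    hF₂.measurable hF₂.dependsOn hF₂.abs_le
    (hF₂.isLipBound zero_le_one (fun a b => by rw [one_mul]; exact dist_suEntries_le_suFrobDist a b))
    hρ0 hρ (fun x y : ZdEdge d => ‖x.1 - y.1‖) (fun _ _ => norm_nonneg _) ht
    (fun x _ => (hrow x).2.1) (fun x _ => (hrow x).2.2.2) (fun y => linkSetDist Λ₂ y) (fun y => linkSetDist_nonneg _ _)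
    (fun y hy => linkSetDist_eq_zero_of_mem hy) (fun x _ y => linkSetDist_le_add_norm Λ₂ x y)
    (m := setDistEdges Λ₁ Λ₂) (fun y hy => setDistEdges_le_linkSetDist hy)
  have hsum₁ : ∑ y ∈ Λ₁, (if y ∈ Λ₁ then 1 * (K₁ : ℝ) else 0) = Λ₁.card * K₁ := by
    rw [Finset.sum_ite_of_true (fun y hy => hy), Finset.sum_const, nsmul_eq_mul, one_mul]
  have hsum₂ : ∑ y ∈ Λ₂, (if y ∈ Λ₂ then 1 * (K₂ : ℝ) else 0) = Λ₂.card * K₂ := by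
    rw [Finset.sum_ite_of_true (fun y hy => hy), Finset.sum_const, nsmul_eq_mul, one_mul]
  rw [hsum₁, hsum₂] at key
  calc |cov[F₁, F₂; perturbedYMS (d := d) (fundamentalRep (Fin N)) (N * β) W Λ η]|
      ≤ 2 * (2 * Real.sqrt N) ^ 2 * (Λ₂.card * K₂) * (Λ₁.card * K₁) * exp (-(t * setDistEdges Λ₁ Λ₂)) := key
    _ = 2 * (2 * Real.sqrt N) ^ 2 * Λ₁.card * Λ₂.card * ((K₁ : ℝ) * K₂) * exp (-(t * setDistEdges Λ₁ Λ₂)) := by ring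

variable (W) in
/-- ★ **TIER 2, EVERY `N ≥ 2`, HYPOTHESIS-FREE (Bakry–Émery pair), PACKAGED ON THE BALL `MemBallZdS a Λ_t t W`**: with
`b = 2(d−1)|β| < 1/2` ('t Hooft `β`, tree coupling `N β`) and the row condition
`6(d−1)|β| e^{a} e^{t}/(1/2 − b) + e^{a/2} Λ_t/√(N(1/2 − b)) < 1`, every member, every finite volume, EVERY boundary field, all Lipschitz
cylinders: `|cov_{γ^{W,S}_Λ(· | η)}(F₁, F₂)| ≤ 2(2√N)² #Λ₁ #Λ₂ K₁ K₂ e^{−t d(Λ₁,Λ₂)}`. [folklore] -/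
theorem suN_kernelS_covariance_decay_bakryEmery (hd : 1 ≤ d) (hN : 2 ≤ N) {β a Λt t : ℝ}
    (hb : |β| * (2 * ((d : ℝ) - 1)) < 1 / 2) (hmem : MemBallZdS a Λt t W) (ht : 0 ≤ t)
    (hρ : 6 * ((d : ℝ) - 1) * |β| * (exp a * exp t) / (1 / 2 - |β| * (2 * ((d : ℝ) - 1))) +
      exp (a / 2) * Λt / Real.sqrt ((N : ℝ) * (1 / 2 - |β| * (2 * ((d : ℝ) - 1)))) < 1)
    (Λ : Finset (ZdEdge d)) (η : LGConfig d (Matrix.specialUnitaryGroup (Fin N) ℂ))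
    {F₁ F₂ : LGConfig d (Matrix.specialUnitaryGroup (Fin N) ℂ) → ℝ} {Λ₁ Λ₂ : Finset (ZdEdge d)} {K₁ K₂ : ℝ≥0}
    (hF₁ : IsLipschitzCylinder (fundamentalRep (Fin N)) F₁ Λ₁ K₁)
    (hF₂ : IsLipschitzCylinder (fundamentalRep (Fin N)) F₂ Λ₂ K₂) :
    |cov[F₁, F₂; perturbedYMS (d := d) (fundamentalRep (Fin N)) (N * β) W Λ η]| ≤
      2 * (2 * Real.sqrt N) ^ 2 * Λ₁.card * Λ₂.card * ((K₁ : ℝ) * K₂) * exp (-(t * setDistEdges Λ₁ Λ₂)) := by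
  obtain ⟨B₀, hB₀⟩ := hmem.summable
  obtain ⟨osc, lip, ℓ, h1, h2, h3, h4, h5, h6, h7, h8⟩ := hmem.loads
  set b : ℝ := |β| * (2 * ((d : ℝ) - 1)) with hbdef
  have hNpos : (0 : ℝ) < N := by exact_mod_cast (show 0 < N by omega)
  have hgap : 0 < 1 / 2 - b := by linarith
  have hP := oneLinkPoincareSUN_bakryEmery hN hb
  have hV := oneLinkVarianceBound_bakryEmery hN hb
  have hc : (0 : ℝ) ≤ 1 / ((N : ℝ) * (1 / 2 - b)) := by positivity
  have hv : (0 : ℝ) ≤ (N : ℝ) / (1 / 2 - b) := by positivity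
  refine kernelS_covariance_decay hd (by omega) hc hv le_rfl (fun B hB => hP B hB) (fun B hB => hV B hB)
    hB₀ hmem.continuous hmem.dependsOn h1 h3 h4 h2 h5 h6 ht h7 h8 ?_ Λ η hF₁ hF₂
  have hsq1 : Real.sqrt (1 / ((N : ℝ) * (1 / 2 - b)) * ((N : ℝ) / (1 / 2 - b))) = 1 / (1 / 2 - b) := by
    rw [show 1 / ((N : ℝ) * (1 / 2 - b)) * ((N : ℝ) / (1 / 2 - b)) = (1 / (1 / 2 - b)) ^ 2 by field_simp,
      Real.sqrt_sq (by positivity)]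
  have hsq2 : Real.sqrt (1 / ((N : ℝ) * (1 / 2 - b))) = 1 / Real.sqrt ((N : ℝ) * (1 / 2 - b)) := by
    rw [Real.sqrt_div' _ (mul_nonneg hNpos.le hgap.le), Real.sqrt_one]
  rw [hsq1, hsq2]
  calc 6 * ((d : ℝ) - 1) * |β| * (exp a * exp t * (1 / (1 / 2 - b))) + exp (a / 2) * (1 / Real.sqrt ((N : ℝ) * (1 / 2 - b))) * Λt
      = 6 * ((d : ℝ) - 1) * |β| * (exp a * exp t) / (1 / 2 - b) + exp (a / 2) * Λt / Real.sqrt ((N : ℝ) * (1 / 2 - b)) := by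
        ring
    _ < 1 := hρ

end SUN

/-! ### `SU(2)` with the sharp one-link pair `(c, v) = (2/3, 8/3)` -/

section SU2

variable {d : ℕ} {W : Potential (ZdEdge d) (Matrix.specialUnitaryGroup (Fin 2) ℂ)} {B : Finset (ZdEdge d) → ℝ}

/-- ★★ **TIER 2, `SU(2)`, HYPOTHESIS-FREE**: for a summable link potential with continuous own-link terms, oscillation load `a`,
diagonal-free weighted cross load `Λ_t` (`t ≥ 0`) and Wilson coupling `β_W` ('t Hooft `β = β_W/4`) with
`2(d−1)|β_W| e^{a} e^{t} + e^{a/2} √(2/3) Λ_t < 1` (the hypothesis of `su2_perturbedMassGapS`): every finite volume, EVERY boundary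
field, all Lipschitz cylinders: `|cov_{γ^{W,S}_Λ(· | η)}(F₁, F₂)| ≤ 2(2√2)² #Λ₁ #Λ₂ K₁ K₂ · e^{−t d(Λ₁,Λ₂)}`. [folklore] -/
theorem su2_kernelS_covariance_decay (hd : 1 ≤ d) {βW a Λt t : ℝ}
    (h : IsLinkSummable W B) (hWc : ∀ X, Continuous (W X))
    (hWdep : ∀ X, DependsOn (W X) (↑X : Set (ZdEdge d)))
    {osc : Finset (ZdEdge d) → ZdEdge d → ℝ} (hosc : ∀ X, Dobrushin.IsOscBound (W X) (osc X))
    (hoscs : ∀ e, Summable fun X : Finset (ZdEdge d) => (if e ∈ X then osc X e else 0))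
    (hosca : ∀ e, ∑' X : Finset (ZdEdge d), (if e ∈ X then osc X e else 0) ≤ a)
    {lip : Finset (ZdEdge d) → ZdEdge d → ℝ} (hlip : ∀ X, IsLipBound suFrobDist (W X) (lip X))
    {ℓ : ZdEdge d → ZdEdge d → ℝ}
    (hlips : ∀ e y, Summable fun X : Finset (ZdEdge d) => (if e ∈ X ∧ y ∈ X then lip X y else 0))
    (hℓ : ∀ e y, y ≠ e → ∑' X : Finset (ZdEdge d), (if e ∈ X ∧ y ∈ X then lip X y else 0) ≤ ℓ e y)
    (ht : 0 ≤ t) (hℓs : ∀ e, Summable fun y => (if y = e then 0 else ℓ e y) * exp (t * ‖e.1 - y.1‖))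
    (hℓt : ∀ e, ∑' y, (if y = e then 0 else ℓ e y) * exp (t * ‖e.1 - y.1‖) ≤ Λt)
    (hρ : 2 * ((d : ℝ) - 1) * |βW| * (exp a * exp t) + exp (a / 2) * Real.sqrt (2 / 3) * Λt < 1)
    (Λ : Finset (ZdEdge d)) (η : LGConfig d (Matrix.specialUnitaryGroup (Fin 2) ℂ))
    {F₁ F₂ : LGConfig d (Matrix.specialUnitaryGroup (Fin 2) ℂ) → ℝ} {Λ₁ Λ₂ : Finset (ZdEdge d)} {K₁ K₂ : ℝ≥0}
    (hF₁ : IsLipschitzCylinder (fundamentalRep (Fin 2)) F₁ Λ₁ K₁)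
    (hF₂ : IsLipschitzCylinder (fundamentalRep (Fin 2)) F₂ Λ₂ K₂) :
    |cov[F₁, F₂; perturbedYMS (d := d) (fundamentalRep (Fin 2)) ((2 : ℕ) * (βW / 4)) W Λ η]| ≤
      2 * (2 * Real.sqrt 2) ^ 2 * Λ₁.card * Λ₂.card * ((K₁ : ℝ) * K₂) * exp (-(t * setDistEdges Λ₁ Λ₂)) := by
  have hc : (0 : ℝ) ≤ 2 / 3 := by norm_num
  have hP : ∀ B : Matrix (Fin 2) (Fin 2) ℂ, matrixOpNorm B ≤ |βW / 4| * (2 * ((d : ℝ) - 1)) →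
      ∀ (ψ : Matrix.specialUnitaryGroup (Fin 2) ℂ → ℝ) (M : ℝ), 0 ≤ M →
        (∀ x y, |ψ x - ψ y| ≤ M * suFrobDist x y) →
        Var[ψ; (haarProbability (Matrix.specialUnitaryGroup (Fin 2) ℂ)).tilted
          fun g => ((2 : ℕ) : ℝ) * ((g : Matrix (Fin 2) (Fin 2) ℂ) * B).trace.re] ≤ 2 / 3 * M ^ 2 :=
    fun B hB ψ M hM hψ => oneLinkPoincareSUN_two_sharp _ B hB ψ M hM hψ
  have hVB := linVariance_of_poincare (N := 2) hP
  have hv : (0 : ℝ) ≤ 2 / 3 * ((2 : ℕ) : ℝ) ^ 2 := by norm_num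
  have hsq : Real.sqrt (2 / 3 * (2 / 3 * ((2 : ℕ) : ℝ) ^ 2)) = 4 / 3 := by
    rw [show (2 / 3 * (2 / 3 * ((2 : ℕ) : ℝ) ^ 2) : ℝ) = (4 / 3) ^ 2 by norm_num, Real.sqrt_sq (by norm_num)]
  have hρ' : 6 * ((d : ℝ) - 1) * |βW / 4| * (exp a * exp t * Real.sqrt (2 / 3 * (2 / 3 * ((2 : ℕ) : ℝ) ^ 2))) +
      exp (a / 2) * Real.sqrt (2 / 3) * Λt < 1 := by
    rw [hsq]
    have e : 6 * ((d : ℝ) - 1) * |βW / 4| * (exp a * exp t * (4 / 3)) = 2 * ((d : ℝ) - 1) * |βW| * (exp a * exp t) := by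
      rw [abs_div, abs_of_pos (by norm_num : (0 : ℝ) < 4)]
      ring
    rw [e]
    exact hρ
  have hmain := kernelS_covariance_decay (N := 2) (β := βW / 4) hd (by norm_num) hc hv le_rfl hP hVB h hWc hWdep
    hosc hoscs hosca hlip hlips hℓ ht hℓs hℓt hρ' Λ η hF₁ hF₂
  have e2 : Real.sqrt ((2 : ℕ) : ℝ) = Real.sqrt 2 := by norm_num
  rw [e2] at hmain
  exact hmain

/-- ★ **TIER 2, `SU(2)`, PACKAGED ON THE BALL `MemBallZdS a Λ_t t W`**: under `2(d−1)|β_W| e^{a} e^{t} + e^{a/2} √(2/3) Λ_t < 1`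
every member of the tier-2 ball, every finite volume, EVERY boundary field, all Lipschitz cylinders:
`|cov_{γ^{W,S}_Λ(· | η)}(F₁, F₂)| ≤ 2(2√2)² #Λ₁ #Λ₂ K₁ K₂ · e^{−t d(Λ₁,Λ₂)}`. [folklore] -/
theorem su2_kernelS_covariance_decay_of_memBallZdS (hd : 1 ≤ d) {βW a Λt t : ℝ} (hmem : MemBallZdS a Λt t W)
    (ht : 0 ≤ t) (hρ : 2 * ((d : ℝ) - 1) * |βW| * (exp a * exp t) + exp (a / 2) * Real.sqrt (2 / 3) * Λt < 1)
    (Λ : Finset (ZdEdge d)) (η : LGConfig d (Matrix.specialUnitaryGroup (Fin 2) ℂ))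
    {F₁ F₂ : LGConfig d (Matrix.specialUnitaryGroup (Fin 2) ℂ) → ℝ} {Λ₁ Λ₂ : Finset (ZdEdge d)} {K₁ K₂ : ℝ≥0}
    (hF₁ : IsLipschitzCylinder (fundamentalRep (Fin 2)) F₁ Λ₁ K₁)
    (hF₂ : IsLipschitzCylinder (fundamentalRep (Fin 2)) F₂ Λ₂ K₂) :
    |cov[F₁, F₂; perturbedYMS (d := d) (fundamentalRep (Fin 2)) ((2 : ℕ) * (βW / 4)) W Λ η]| ≤
      2 * (2 * Real.sqrt 2) ^ 2 * Λ₁.card * Λ₂.card * ((K₁ : ℝ) * K₂) * exp (-(t * setDistEdges Λ₁ Λ₂)) := by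
  obtain ⟨B, hB⟩ := hmem.summable
  obtain ⟨osc, lip, ℓ, h1, h2, h3, h4, h5, h6, h7, h8⟩ := hmem.loads
  exact su2_kernelS_covariance_decay hd hB hmem.continuous hmem.dependsOn h1 h3 h4 h2 h5 h6 ht h7 h8 hρ Λ η hF₁ hF₂

end SU2

end Summit.Ventures.YMGap.RobustBall

end
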